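/-
Copyright (c) 2026. All rights reserved.
Released under Apache 2.0 license as described in the file LICENSE.
Authors: abc-iut cell, statement-typer seat abc-iut-L4-t3 (wave 1; gen 8), over abc-iut-f-101's contact structure
(`LogFrobeniusMonoTelecoreContact`) and abc-iut-L4-t5's relative families (`DiagramRelativeFamilies`).
-/
import Literature.AnabelianGeometry.AbsoluteAnabelian.LogFrobeniusMonoTelecoreIotaFrames
import HarnessLib

/-!
# [AbsTopIII] Cor 5.10 (iv)(c): `ℋ_{An⊢}` WITH the `ι^{An⊢⊞}`-generators — the family, its pairs, and `Cor510MonoTelecorePinnedIota`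

S. Mochizuki, *Topics in absolute anabelian geometry III*, J. Math. Sci. Univ. Tokyo 22 (2015) 939–1156
[MochizukiAbsTopIII2015]; manuscript pages (`paper:url-5493eb38cbb7`): Cor 5.10 (iv)(c) p. 148 l. 39–51; Def 3.5 (ii) p. 75,
(iv) p. 76 (a contact structure: a family of homotopies on `𝒯` compatible with the telecore family `𝒥`); §0 p. 26.

WHY («F-0139″-CLOSER», third brick: the CLOSER of this lineage's `Cor510MonoTelecorePinnedIota`,
`LogFrobeniusMonoTelecorePinnedIota.lean`; proof-side, nothing restated).  From the extended relative lifts `MRelI` / `θI`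
(`LogFrobeniusMonoTelecoreIotaFrames`):
* `MθI`, `monoRelLiftsIota` — the `RelLifts` datum (`W = {An⊢} ∪ {𝒩⊢⊞_v}`; abc-iut-L4-t5's lift at the core vertex, `θI` at
  `𝒩⊢⊞_v`; the four laws of Def 3.5 (ii) assembled from the second brick), ★ `monoContactIota := relFamily _` — the contact
  structure `ℋ_{An⊢}` WITH the `ι^{An⊢⊞}`-generators;
* `monoContactIota_isContactStructure` — compatible with `𝒥` (it contains `𝒥`: every pair into `An⊢` is related, and on such a
  pair both families give the lift at the core vertex), verbatim abc-iut-f-101's argument;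
* `monoContactIota_pairs` — the printed pairs `(γ¹_{v,ν}, γ⁰_{v,ν})` in both orders (same class, `ν ⤳ ν`);
  ★ `monoContactIota_iota` — for every edge `ε : ν₁ → ν₂` of `Γ⃗×_v` the pair `([φ_{ν₁}], [φ_{ν₂}])` IS a boundary pair and its
  homotopy IS `ι^{An⊢⊞}_{v,ε}` (up to the cast `𝒟_[[φ_ν]] = 𝟭 ⋙ ψ_ν`): `θI` on two bare telecore edges is `Θ ≫ ι ≫ Θ⁻¹` with
  frames reduced to casts (`pathIso_nil`);
* ★ `MonoTelecoreCoherence.cor510MonoTelecorePinnedIota_of` — **SUFFICIENCY: `(M, K, I)` + `I.SquaresCommute` + `K.EtaNatural I`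
  ⇒ `Cor510MonoTelecorePinnedIota L`** (`V(F_mod) ≠ ∅`); the `EtaNatural` clause is carried as data (clause (1) of the
  statement), the square is what the family needs;
* ★ `cor510MonoTelecorePinnedIota_genuineOpen` — **it HOLDS at the genuine open-augmentation carrier** (abc-iut-f-101's
  `monoTelecoreCoherence_open`, this lineage's `etaNatural_genuineOpen` and `squaresCommute_genuineOpen`): the first
  model-level instance of Cor 5.10 (iv)(c)'s generation clause with the `ι^{An⊢⊞}`-pairs at a genuine carrier.
Refereed pre-IUT material; OUR constructions / kernel checks; nothing here bears on [IUTchIII] Cor. 3.12; no side taken;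
typed ≠ proved.
-/

set_option autoImplicit false

universe u

open CategoryTheory Quiver

namespace Literature.AnabelianGeometry.AbsoluteAnabelian

namespace LogFrobeniusSetting

variable {Vmod : Type u} {isArc : Vmod → Bool} (L : LogFrobeniusSetting Vmod isArc)
  (hN : ∀ v : Vmod, L.monoN v ⋙ L.toEmono v ≅ L.toE v ⋙ L.monoAn)
  (hψ : ∀ (w : Vmod) (j : {ν : LogVertex (isArc w) // ν.IsCross}),
    L.ψAnMono w j ⋙ L.forgetMono w ⋙ L.toEmono w ≅ L.κAnMono.inverse)
  (hη : ∀ (v : Vmod) (ν : LogVertex (isArc v)) (hν : ν.IsCross),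
    L.lam v ν ⋙ L.forget v ⋙ L.toE v ⋙ L.monoAn ⋙ L.κAnMono.functor ⋙ L.ψAnMono v ⟨ν, hν⟩ ≅ L.lam v ν ⋙ L.monoNplus v)
  (I : L.IotaAnMono hψ)

-- the coherence hypothesis `hcoh`: «`η⊢_{v,ν}` lies over `ℰ⊢`» (abc-iut-f-101's binder, verbatim)
variable (hcoh : ∀ (v : Vmod) (ν : LogVertex (isArc v)) (hν : ν.IsCross) (y : L.X),
  (L.toEmono v).map ((L.forgetMono v).map ((hη v ν hν).hom.app y)) ≫
    (L.toEmono v).map ((L.monoHomotopy v).hom.app ((L.lam v ν).obj y)) ≫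
      (hN v).hom.app ((L.forget v).obj ((L.lam v ν).obj y)) =
  (hψ v ⟨ν, hν⟩).hom.app ((L.lam v ν ⋙ L.forget v ⋙ L.toE v ⋙ L.monoAn ⋙ L.κAnMono.functor).obj y) ≫
    L.κAnMono.unitIso.inv.app ((L.lam v ν ⋙ L.forget v ⋙ L.toE v ⋙ L.monoAn).obj y))

/-! ## The relative-lifts datum and the extended contact structure -/

/-- **the extended relative lift** at a vertex of `W`: abc-iut-L4-t5's lift at the core vertex, `θI` at `𝒩⊢⊞_v`.
[cite: MochizukiAbsTopIII2015, Definition 3.5 (ii) p.75] -/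
noncomputable def MθI : ∀ ⦃a w : (monoTeleShape Vmod isArc).Vertex⦄, MW w → ∀ ⦃p q : Path a w⦄, MRelI p q →
    (L.monoTeleDiagram.pathFunctor p ⟶ L.monoTeleDiagram.pathFunctor q)
  | _, ExtVertex.obs, _, p, q, _ => (L.monoTeleOver hN hψ).lift (L.ffCore hN hψ) p q
  | _, ExtVertex.base ⟨.nmonoPlus _, _⟩, _, _, _, hr => L.θI hN hψ hη I hr
  | _, ExtVertex.base ⟨.row1 _, _⟩, hw, _, _, _ => hw.elim
  | _, ExtVertex.base ⟨.core, _⟩, hw, _, _, _ => hw.elim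
  | _, ExtVertex.base ⟨.nplus _, _⟩, hw, _, _, _ => hw.elim
  | _, ExtVertex.base ⟨.nv _, _⟩, hw, _, _, _ => hw.elim
  | _, ExtVertex.base ⟨.e5, _⟩, hw, _, _, _ => hw.elim
  | _, ExtVertex.base ⟨.an, _⟩, hw, _, _, _ => hw.elim
  | _, ExtVertex.base ⟨.e7, _⟩, hw, _, _, _ => hw.elim
  | _, ExtVertex.base ⟨.nmono _, _⟩, hw, _, _, _ => hw.elim
  | _, ExtVertex.base ⟨.emono5, _⟩, hw, _, _, _ => hw.elim
  | _, ExtVertex.base ⟨.anMono, _⟩, hw, _, _, _ => hw.elim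
  | _, ExtVertex.base ⟨.emono7, _⟩, hw, _, _, _ => hw.elim

/-- at the core vertex: the lift. [cite: MochizukiAbsTopIII2015, Definition 3.5 (ii) p.75] -/
theorem MθI_obs {a : (monoTeleShape Vmod isArc).Vertex} (hw : MW (coreVx Vmod isArc))
    {p q : Path a (coreVx Vmod isArc)} (h : MRelI p q) :
    L.MθI hN hψ hη I hw h = (L.monoTeleOver hN hψ).lift (L.ffCore hN hψ) p q := rfl

/-- at `𝒩⊢⊞_v`: the extended lift. [cite: MochizukiAbsTopIII2015, Definition 3.5 (ii) p.75] -/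
theorem MθI_nmonoPlus {a : (monoTeleShape Vmod isArc).Vertex} {v : Vmod} (hw : MW (nmonoPlusVx (isArc := isArc) v))
    {p q : Path a (nmonoPlusVx (isArc := isArc) v)} (h : MRelI p q) :
    L.MθI hN hψ hη I hw h = L.θI hN hψ hη I h := rfl

/-- identity law. [cite: MochizukiAbsTopIII2015, Definition 3.5 (ii) p.75] -/
theorem MθI_self {a w : (monoTeleShape Vmod isArc).Vertex} (hw : MW w) {p : Path a w} (h : MRelI p p) :
    L.MθI hN hψ hη I hw h = 𝟙 _ := by
  rcases eq_of_mw hw with rfl | ⟨v, rfl⟩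
  · exact (L.monoTeleOver hN hψ).lift_self (L.ffCore hN hψ) p
  · exact L.θI_self hN hψ hη I h

/-- composition law (under the `ι^{An⊢⊞}`-square). [cite: MochizukiAbsTopIII2015, Definition 3.5 (ii) p.75] -/
theorem MθI_trans (hsq : I.SquaresCommute) {a w : (monoTeleShape Vmod isArc).Vertex} (hw : MW w) {p q r : Path a w}
    (h₁ : MRelI p q) (h₂ : MRelI q r) (h₃ : MRelI p r) :
    L.MθI hN hψ hη I hw h₁ ≫ L.MθI hN hψ hη I hw h₂ = L.MθI hN hψ hη I hw h₃ := by
  rcases eq_of_mw hw with rfl | ⟨v, rfl⟩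
  · exact (L.monoTeleOver hN hψ).lift_trans (L.ffCore hN hψ) p q r
  · exact L.θI_trans hN hψ hη I hsq h₁ h₂ h₃

/-- pre-composition law. [cite: MochizukiAbsTopIII2015, Definition 3.5 (ii) p.75] -/
theorem MθI_precomp_heq {c a w : (monoTeleShape Vmod isArc).Vertex} (hw : MW w) (r : Path c a) {p q : Path a w}
    (h : MRelI p q) (h' : MRelI (r.comp p) (r.comp q)) :
    L.MθI hN hψ hη I hw h' ≍ Functor.whiskerLeft (L.monoTeleDiagram.pathFunctor r) (L.MθI hN hψ hη I hw h) := by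
  rcases eq_of_mw hw with rfl | ⟨v, rfl⟩
  · exact (L.monoTeleOver hN hψ).lift_precomp_heq (L.ffCore hN hψ) r p q
  · exact L.θI_precomp_heq hN hψ hη I r h h'

include hcoh in
/-- every extended lift lies over the structure isomorphisms. [cite: MochizukiAbsTopIII2015, Remark 3.5.1 p.78] -/
theorem MθI_over {a w : (monoTeleShape Vmod isArc).Vertex} (hw : MW w) {p q : Path a w} (h : MRelI p q)
    (x : L.monoTeleDiagram.obj a) :
    ((L.monoTeleOver hN hψ).N w).map ((L.MθI hN hψ hη I hw h).app x) =
      ((L.monoTeleOver hN hψ).pathIso p).hom.app x ≫ ((L.monoTeleOver hN hψ).pathIso q).inv.app x := by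
  rcases eq_of_mw hw with rfl | ⟨v, rfl⟩
  · exact (L.monoTeleOver hN hψ).map_lift_app (L.ffCore hN hψ) p q x
  · exact L.θI_over hN hψ hη I hcoh h x

include hcoh in
/-- post-composition law by a path between vertices of `W` (into the core: uniqueness of lifts; into `𝒩⊢⊞_{v′}`: the path is
empty or ends with a telecore edge). [cite: MochizukiAbsTopIII2015, Definition 3.5 (ii) p.75] -/
theorem MθI_postcomp_heq {a w w' : (monoTeleShape Vmod isArc).Vertex} (hw : MW w) (hw' : MW w') {p q : Path a w}
    (t : Path w w') (h : MRelI p q) (h' : MRelI (p.comp t) (q.comp t)) :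
    L.MθI hN hψ hη I hw' h' ≍ Functor.whiskerRight (L.MθI hN hψ hη I hw h) (L.monoTeleDiagram.pathFunctor t) := by
  rcases eq_of_mw hw' with rfl | ⟨v', rfl⟩
  · exact L.lift_comp_heq_of_over hN hψ (L.MθI hN hψ hη I hw h) (L.MθI_over hN hψ hη I hcoh hw h) t
  · cases t with
    | nil =>
      refine natTrans_heq_of_app (DiagramOfCategories.pathFunctor_comp _ _ _)
        (DiagramOfCategories.pathFunctor_comp _ _ _) fun x => ?_
      exact (Functor.hcongr_hom (L.monoTeleDiagram.pathFunctor_nil _) ((L.MθI hN hψ hη I hw h).app x)).symm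
    | cons t e =>
      rename_i b
      rcases b with ⟨⟨b, hb⟩⟩ | _
      · change DEdge isArc b (.nmonoPlus v') at e
        cases e
        exact ((notTop_of_path t (mw_notTop hw) : NotTop _) : False).elim
      · change MonoTelecoreIdx (DVertex.nmonoPlus (isArc := isArc) v') at e
        obtain ⟨ν', hν'⟩ := e
        exact L.θI_comp_tel_heq hN hψ hη I (L.MθI hN hψ hη I hw h) (L.MθI_over hN hψ hη I hcoh hw h) t ν' hν' h'

include hcoh in
/-- **the extended relative lifts** as a `RelLifts` datum (`W = {An⊢} ∪ {𝒩⊢⊞_v}`, relation `MRelI`, homotopies `MθI`), under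
the `ι^{An⊢⊞}`-square. [cite: MochizukiAbsTopIII2015, Definition 3.5 (ii) p.75] -/
noncomputable def monoRelLiftsIota (hsq : I.SquaresCommute) : L.monoTeleDiagram.RelLifts where
  W := MW
  Rel := fun _ _ p q => MRelI p q
  θ := fun _ _ hw _ _ h => L.MθI hN hψ hη I hw h
  rel_refl_left := fun _ _ _ _ hw h => mrelI_refl_left hw h
  rel_refl_right := fun _ _ _ _ hw h => mrelI_refl_right hw h
  rel_trans := fun _ _ _ _ _ hw h₁ h₂ => mrelI_trans hw h₁ h₂
  rel_precomp := fun _ _ _ r _ _ hw h => mrelI_precomp r hw h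
  rel_postcomp := fun _ _ _ _ _ t hw hw' h => mrelI_postcomp t hw hw' h
  θ_self := fun _ _ hw _ h => L.MθI_self hN hψ hη I hw h
  θ_trans := fun _ _ hw _ _ _ h₁ h₂ h₃ => L.MθI_trans hN hψ hη I hsq hw h₁ h₂ h₃
  θ_precomp_heq := fun _ _ _ hw r _ _ h h' => L.MθI_precomp_heq hN hψ hη I hw r h h'
  θ_postcomp_heq := fun _ _ _ hw hw' _ _ t h h' => L.MθI_postcomp_heq hN hψ hη I hcoh hw hw' t h h'

include hcoh in
/-- ★ **the contact structure `ℋ_{An⊢}` WITH the `ι^{An⊢⊞}`-generators**: the family of homotopies of the extended relative lifts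
(Def 3.5 (ii): identity, composition, whiskering PROVED by abc-iut-L4-t5's `relFamily`).
[cite: MochizukiAbsTopIII2015, Cor 5.10 (iv)(c) p.148] -/
noncomputable def monoContactIota (hsq : I.SquaresCommute) : L.monoTeleDiagram.HomotopyFamily :=
  DiagramOfCategories.relFamily (L.monoRelLiftsIota hN hψ hη I hcoh hsq)


/-! ## Compatibility with the telecore family `𝒥` -/

include hcoh in
/-- the telecore pairs (through the core vertex `An⊢`) are boundary pairs (every pair into `An⊢` is related).
[cite: MochizukiAbsTopIII2015, Definition 3.5 (iv) p.76] -/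
theorem monoContactIota_E_of_jfam [Nonempty Vmod] (hsq : I.SquaresCommute) {a b : (monoTeleShape Vmod isArc).Vertex}
    {p q : Path a b} (h : (L.monoTelecore hN hψ).Jfam.E p q) : (L.monoContactIota hN hψ hη I hcoh hsq).E p q := by
  obtain ⟨⟨w, hw, p₁, q₁, s, hp, hq⟩⟩ := h
  subst hw
  exact ⟨⟨(monoTeleShape Vmod isArc).obs, trivial, p₁, q₁, s, trivial, hp, hq⟩⟩

include hcoh in
/-- on a telecore pair both families give abc-iut-L4-t5's lift at the core vertex whiskered by the common suffix.
[cite: MochizukiAbsTopIII2015, Definition 3.5 (iv) p.76] -/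
theorem monoTelecore_η_eq_iota [Nonempty Vmod] (hsq : I.SquaresCommute) {a b : (monoTeleShape Vmod isArc).Vertex}
    {p q : Path a b} (h : (L.monoTelecore hN hψ).Jfam.E p q) :
    (L.monoTelecore hN hψ).Jfam.η h =
      (L.monoContactIota hN hψ hη I hcoh hsq).η (L.monoContactIota_E_of_jfam hN hψ hη I hcoh hsq h) := by
  obtain ⟨⟨w, hw, p₁, q₁, s, hp, hq⟩⟩ := h
  subst hw
  change (DiagramOfCategories.univFamily (L.monoTeleOver hN hψ) (· = (monoTeleShape Vmod isArc).obs)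
    (L.monoTeleOver_ff hN hψ)).η _ = (DiagramOfCategories.relFamily (L.monoRelLiftsIota hN hψ hη I hcoh hsq)).η _
  refine (DiagramOfCategories.univFamily_η_eq (L.monoTeleOver hN hψ) (· = (monoTeleShape Vmod isArc).obs)
    (L.monoTeleOver_ff hN hψ) _ ⟨(monoTeleShape Vmod isArc).obs, rfl, p₁, q₁, s, hp, hq⟩).trans ?_
  refine Eq.trans ?_ (DiagramOfCategories.relFamily_η_eq (L.monoRelLiftsIota hN hψ hη I hcoh hsq) _
    ⟨(monoTeleShape Vmod isArc).obs, trivial, p₁, q₁, s, trivial, hp, hq⟩).symm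
  rfl

include hcoh in
/-- **`ℋ_{An⊢}` with the `ι^{An⊢⊞}`-generators is a contact structure for `𝔗_{An⊢}`** (Def 3.5 (iv): compatible with `𝒥`, witnessed
by itself). [cite: MochizukiAbsTopIII2015, Definition 3.5 (iv) p.76] -/
theorem monoContactIota_isContactStructure [Nonempty Vmod] (hsq : I.SquaresCommute) :
    DiagramOfCategories.Telecore.IsContactStructure _ (L.monoTelecore hN hψ) (L.monoContactIota hN hψ hη I hcoh hsq) := by
  refine ⟨L.monoContactIota hN hψ hη I hcoh hsq, fun i => ?_⟩
  cases i
  · exact ⟨fun _ _ _ _ h => L.monoContactIota_E_of_jfam hN hψ hη I hcoh hsq h,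
      fun _ _ _ _ h => L.monoTelecore_η_eq_iota hN hψ hη I hcoh hsq h⟩
  · exact ⟨fun _ _ _ _ h => h, fun _ _ _ _ _ => rfl⟩

/-! ## The printed pairs and the `ι^{An⊢⊞}`-pairs -/

include hcoh in
/-- the printed pairs `(γ¹_{v,ν}, γ⁰_{v,ν})`, in both orders, are boundary pairs (same class `A_ν`, `ν ⤳ ν`).
[cite: MochizukiAbsTopIII2015, Cor 5.10 (iv)(c) p.148] -/
theorem monoContactIota_pairs (hsq : I.SquaresCommute) (v : Vmod) (ν : LogVertex (isArc v)) (hν : ν.IsCross) :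
    (L.monoContactIota hN hψ hη I hcoh hsq).E (gammaOne v ν hν) (gammaZero v ν hν) ∧
      (L.monoContactIota hN hψ hη I hcoh hsq).E (gammaZero v ν hν) (gammaOne v ν hν) :=
  ⟨DiagramOfCategories.relE_of_rel (L.monoRelLiftsIota hN hψ hη I hcoh hsq) (w := nmonoPlusVx v) trivial
      ⟨ν, ν, hν, hν, inA_cons_telE hν (gammaOnePrefix v ν hν), Or.inr ⟨⟨Path.nil, rfl⟩⟩, LogVertex.Reach.refl hν⟩,
    DiagramOfCategories.relE_of_rel (L.monoRelLiftsIota hN hψ hη I hcoh hsq) (w := nmonoPlusVx v) trivial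
      ⟨ν, ν, hν, hν, Or.inr ⟨⟨Path.nil, rfl⟩⟩, inA_cons_telE hν (gammaOnePrefix v ν hν), LogVertex.Reach.refl hν⟩⟩

include hcoh in
/-- the `ι^{An⊢⊞}`-pair `([φ_{ν₁}], [φ_{ν₂}])` of an edge `ε : ν₁ → ν₂` of `Γ⃗×_v` is a boundary pair.
[cite: MochizukiAbsTopIII2015, Cor 5.10 (iv)(c) p.148] -/
theorem monoContactIota_E_telPath (hsq : I.SquaresCommute) (v : Vmod) {ν₁ ν₂ : LogVertex (isArc v)}
    (ε : LogEdgeTS (isArc v) ν₁ ν₂) (hε : ε.InCore) :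
    (L.monoContactIota hN hψ hη I hcoh hsq).E (telPath v ν₁ hε.isCross_src) (telPath v ν₂ hε.isCross_tgt) :=
  DiagramOfCategories.relE_of_rel (L.monoRelLiftsIota hN hψ hη I hcoh hsq) (w := nmonoPlusVx v) trivial
    (mrelI_cons_telE Path.nil ε hε)

/-- the functor of a bare telecore edge `[φ^{An⊢⊞}_{v,ν}]` is `ψ^{An⊢⊞}_{v,ν}`. [cite: MochizukiAbsTopIII2015, Cor 5.10 (iv)(b) p.147] -/
theorem pathFunctor_telPath (v : Vmod) (ν : LogVertex (isArc v)) (hν : ν.IsCross) :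
    L.monoTeleDiagram.pathFunctor (telPath v ν hν) = L.ψAnMono v ⟨ν, hν⟩ := by
  rw [telPath, DiagramOfCategories.pathFunctor_cons, DiagramOfCategories.pathFunctor_nil]
  exact Functor.id_comp _

/-- the frame of a bare telecore edge is a cast (the structure isomorphism of the empty path is a cast).
[cite: MochizukiAbsTopIII2015, Remark 3.5.1 p.78] -/
theorem ΘT_nil_hom_app (v : Vmod) (ν : LogVertex (isArc v)) (hν : ν.IsCross) (X : L.AnMono) :
    (L.ΘT hN hψ (p := telPath v ν hν) ⟨Path.nil, rfl⟩).hom.app X ≍ 𝟙 ((L.ψAnMono v ⟨ν, hν⟩).obj X) := by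
  rw [L.ΘT_hom_app hN hψ, DiagramOfCategories.OverData.pathIso_nil_app]
  erw [eqToHom_map]
  exact (eqToHom_comp_heq_iff _ _ _).2 (eqToHom_heq_id_cod _ _ _)

/-- … and so is its inverse. [cite: MochizukiAbsTopIII2015, Remark 3.5.1 p.78] -/
theorem ΘT_nil_inv_app (v : Vmod) (ν : LogVertex (isArc v)) (hν : ν.IsCross) (X : L.AnMono) :
    (L.ΘT hN hψ (p := telPath v ν hν) ⟨Path.nil, rfl⟩).inv.app X ≍ 𝟙 ((L.ψAnMono v ⟨ν, hν⟩).obj X) := by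
  have e : (L.monoTeleDiagram.pathFunctor (telPath v ν hν)).obj X = (L.ψAnMono v ⟨ν, hν⟩).obj X :=
    Functor.congr_obj (L.pathFunctor_telPath v ν hν) X
  have hhom : (L.ΘT hN hψ (p := telPath v ν hν) ⟨Path.nil, rfl⟩).hom.app X = eqToHom e :=
    eq_of_heq ((L.ΘT_nil_hom_app hN hψ v ν hν X).trans (eqToHom_heq_id_cod _ _ e).symm)
  have hinv : (L.ΘT hN hψ (p := telPath v ν hν) ⟨Path.nil, rfl⟩).inv.app X = eqToHom e.symm :=
    Iso.inv_ext (f := (L.ΘT hN hψ (p := telPath v ν hν) ⟨Path.nil, rfl⟩).app X)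
      (by rw [Iso.app_hom, hhom]; erw [eqToHom_trans, eqToHom_refl])
  rw [hinv]
  exact eqToHom_heq_id_dom _ _ _

include hcoh in
/-- ★ **the homotopy of the `ι^{An⊢⊞}`-pair `([φ_{ν₁}], [φ_{ν₂}])` IS `ι^{An⊢⊞}_{v,ε}`** (up to the cast `𝒟_[[φ_ν]] = 𝟭 ⋙ ψ_ν`): on two
bare telecore edges `θI = Θ ≫ ι^{An⊢⊞}_{ν₁⤳ν₂} ≫ Θ⁻¹` with both frames casts and the chain along one edge the edge's datum.
[cite: MochizukiAbsTopIII2015, Cor 5.10 (iv)(c) p.148] -/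
theorem monoContactIota_iota (hsq : I.SquaresCommute) (v : Vmod) {ν₁ ν₂ : LogVertex (isArc v)}
    (ε : LogEdgeTS (isArc v) ν₁ ν₂) (hε : ε.InCore) :
    HEq ((L.monoContactIota hN hψ hη I hcoh hsq).η (L.monoContactIota_E_telPath hN hψ hη I hcoh hsq v ε hε))
      (I.ι v ε hε) := by
  have hθ : (L.monoContactIota hN hψ hη I hcoh hsq).η (L.monoContactIota_E_telPath hN hψ hη I hcoh hsq v ε hε) =
      L.θI hN hψ hη I (mrelI_cons_telE Path.nil ε hε) :=
    DiagramOfCategories.relFamily_η_eq_θ (L.monoRelLiftsIota hN hψ hη I hcoh hsq) (w := nmonoPlusVx v) trivial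
      (mrelI_cons_telE Path.nil ε hε) _
  rw [hθ, L.θI_eq hN hψ hη I _ (.inl ⟨Path.nil, rfl⟩) (.inl ⟨Path.nil, rfl⟩) (LogVertex.Reach.of_inCore hε)]
  refine natTrans_heq_of_app (L.pathFunctor_telPath v ν₁ _) (L.pathFunctor_telPath v ν₂ _) fun X => ?_
  rw [NatTrans.comp_app, NatTrans.comp_app, Functor.whiskerLeft_app]
  change (L.ΘT hN hψ (p := telPath v ν₁ _) ⟨Path.nil, rfl⟩).hom.app X ≫ (I.chain v _).app X ≫
    (L.ΘT hN hψ (p := telPath v ν₂ _) ⟨Path.nil, rfl⟩).inv.app X ≍ (I.ι v ε hε).app X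
  rw [I.chain_ι v ε hε]
  have e₁ : (L.monoTeleDiagram.pathFunctor (telPath v ν₁ hε.isCross_src)).obj X =
      (L.ψAnMono v ⟨ν₁, hε.isCross_src⟩).obj X := Functor.congr_obj (L.pathFunctor_telPath v ν₁ _) X
  have e₂ : (L.monoTeleDiagram.pathFunctor (telPath v ν₂ hε.isCross_tgt)).obj X =
      (L.ψAnMono v ⟨ν₂, hε.isCross_tgt⟩).obj X := Functor.congr_obj (L.pathFunctor_telPath v ν₂ _) X
  refine (heq_comp e₁ rfl e₂ (L.ΘT_nil_hom_app hN hψ v ν₁ _ X)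
    (heq_comp rfl rfl e₂ HEq.rfl (L.ΘT_nil_inv_app hN hψ v ν₂ _ X))).trans ?_
  erw [Category.id_comp, Category.comp_id]
  rfl

/-! ## Sufficiency, and the genuine instance -/

include hcoh in
/-- **SUFFICIENCY over the raw binders**: (a) + (c) + (d) + coherence + `ι^{An⊢⊞}`-data with its square give the contact-structure
clauses of `Cor510MonoTelecorePinnedIota` for THE telecore `monoTelecore hN hψ`. [cite: MochizukiAbsTopIII2015, Cor 5.10 (iv)(c) p.148] -/
theorem exists_monoContactIota [Nonempty Vmod] (hsq : I.SquaresCommute) :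
    ∃ Hc : L.monoTeleDiagram.HomotopyFamily,
      DiagramOfCategories.Telecore.IsContactStructure _ (L.monoTelecore hN hψ) Hc ∧
        (∀ (v : Vmod) (ν : LogVertex (isArc v)) (hν : ν.IsCross),
          Hc.E (gammaOne v ν hν) (gammaZero v ν hν) ∧ Hc.E (gammaZero v ν hν) (gammaOne v ν hν)) ∧
        ∀ (v : Vmod) ⦃ν₁ ν₂ : LogVertex (isArc v)⦄ (ε : LogEdgeTS (isArc v) ν₁ ν₂) (hε : ε.InCore),
          ∃ h : Hc.E (telPath v ν₁ hε.isCross_src) (telPath v ν₂ hε.isCross_tgt), HEq (Hc.η h) (I.ι v ε hε) :=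
  ⟨L.monoContactIota hN hψ hη I hcoh hsq, L.monoContactIota_isContactStructure hN hψ hη I hcoh hsq,
    L.monoContactIota_pairs hN hψ hη I hcoh hsq,
    fun v _ _ ε hε => ⟨L.monoContactIota_E_telPath hN hψ hη I hcoh hsq v ε hε, L.monoContactIota_iota hN hψ hη I hcoh hsq v ε hε⟩⟩

/-- ★ **SUFFICIENCY for `F-0139″`: `(M, K, I)` + the `ι^{An⊢⊞}`-square + the `η⊢`-naturality square ⇒ `Cor510MonoTelecorePinnedIota L`**
(`V(F_mod) ≠ ∅`), the binders fed BY NAME (`M.toE`, `K.psiOver`, `K.eta`, `K.eta_over`).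
[cite: MochizukiAbsTopIII2015, Cor 5.10 (iv)(c) p.148] -/
theorem MonoTelecoreCoherence.cor510MonoTelecorePinnedIota_of {L : LogFrobeniusSetting Vmod isArc}
    {M : L.MonoAnalyticizationHomotopies} (K : L.MonoTelecoreCoherence M) (I : K.IotaData) [Nonempty Vmod]
    (hsq : I.SquaresCommute) (hE : K.EtaNatural I) : L.Cor510MonoTelecorePinnedIota :=
  ⟨M, K, I, hE, L.exists_monoContactIota M.toE K.psiOver K.eta I K.eta_over hsq⟩

open AbsTopIII in
/-- ★ **`F-0139″` HOLDS at the genuine open-augmentation carrier** `genuineOpen p V` (`V ≠ ∅`): abc-iut-f-101's coherence datum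
`monoTelecoreCoherence_open`, this lineage's genuine `ι^{An⊢⊞}`-data (abc-iut-w5-d053 / abc-iut-w4-d095), `squaresCommute_genuineOpen`
and `etaNatural_genuineOpen`. [cite: MochizukiAbsTopIII2015, Cor 5.10 (iv)(c) p.148] -/
theorem cor510MonoTelecorePinnedIota_genuineOpen (p : ℕ) [Fact p.Prime] (Vmod : Type 1) [Nonempty Vmod] :
    (genuineOpen p Vmod).Cor510MonoTelecorePinnedIota :=
  (monoTelecoreCoherence_open p Vmod).cor510MonoTelecorePinnedIota_of
    (nonarchGenuineMonoAnPfOpen_iotaAnMono p Vmod (fun _ => false))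
    (squaresCommute_genuineOpen p Vmod) (etaNatural_genuineOpen p Vmod)

open AbsTopIII in
/-- Hence a §5 setting with `V(F_mod) ≠ ∅` satisfying `F-0139″` EXISTS (model-level non-vacuity of the statement with the
`ι^{An⊢⊞}`-pairs pinned). [cite: MochizukiAbsTopIII2015, Cor 5.10 (iv)(c) p.148] -/
theorem exists_genuine_cor510MonoTelecorePinnedIota (p : ℕ) [Fact p.Prime] (Vmod : Type 1) [Nonempty Vmod] :
    ∃ L : LogFrobeniusSetting Vmod (fun _ => false), L.Cor510MonoTelecorePinnedIota :=
  ⟨genuineOpen p Vmod, cor510MonoTelecorePinnedIota_genuineOpen p Vmod⟩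

end LogFrobeniusSetting

end Literature.AnabelianGeometry.AbsoluteAnabelian
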